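import Summits.ResolutionOfSingularities.ResolutionOfSingularities.Theorems.WeightedInvariantIota3FibreDescentEngine
import Summits.ResolutionOfSingularities.ResolutionOfSingularities.Theorems.WeightedInvariantIota3SigmaAscent
import Literature.AlgebraicGeometry.Resolution.FlatSlicingCriterion
import HarnessLib

/-!
# Descent of `𝔪'`-primary ideals at the generic points of the fibre, LOCALISED FORM, and the two-flag levels

Helper for `stub_keyRungGrHomLE_three` of `HypersurfaceCentreConstruction` (stmt-ResolutionOfSingularities-19897), hypothesis
(IDLexact)₃ of the gap list of record `keyRungGrHomLE_three_of_idealDescentExact4` (p820504).  Sequel of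
`…Iota3FibreDescentEngine` (p822040).  [OURS · descent engine; AI work, weaker than expert review.]

WHAT IS PROVED.  `T → T'` an algebra with `T'` local and flat over `T`, `C := T' ⊗_T T'`, `p₁ = includeLeft` (the structure map
of the left `T'`-algebra `C`), `p₂ = includeRight`, fibre ideal `F := p₁(𝔪')C`.
* §1 (any ring): at a minimal prime `𝔓` of a RADICAL ideal `F`, `𝔓·C_𝔓 = F·C_𝔓 = 𝔪_{C_𝔓}` (`map_le_map_atPrime_of_mem_minimalPrimes`,
  `maximalIdeal_atPrime_eq_map_of_mem_minimalPrimes`).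
* §2: with `𝔪T' = 𝔪'` the fibre ideal is `𝔪C` and is ALSO `p₂(𝔪')C` (`map_includeLeft_maximalIdeal_eq`, `…includeRight…`); hence BOTH
  composites `q₁, q₂ : T' ⇉ C → C_𝔓` satisfy `qᵢ(𝔪')C_𝔓 = 𝔪_{C_𝔓}` (`map_maximalIdeal_toAtPrime_left/right`): the generic points of the
  fibre are again in the `𝔪`-preserving class.
* §3 **`eq_map_comap_of_atPrime`**: if `T'/I` has finite length, `F` is radical with finitely many minimal primes, and at every
  minimal prime `𝔓` of `F` the LOCALISED datum `I·^{q₂}C_𝔓 ≤ I·^{q₁}C_𝔓` holds, then `I = (I ∩ T)·T'` (the engine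
  `FibreDescent.eq_map_comap_of_minimalPrimes` + clearing denominators).
* §4 **`flagLevel_extended_of_generic_invariance`**: for a two-flag filtration level `F' = flagContactFiltration g₁' g₂' q r₁ r₂ n` of
  `T'` (`T'` Noetherian local, `𝔪T' = 𝔪'`): if at every generic point `C_𝔓` of the fibre the level-`n` filtration of the image flag
  under `q₂` lies in that of the image flag under `q₁`, then `F'` is extended from `T`.  By `Iota3.map_flagContactFiltration_eq` the two
  sides are `F'·^{qᵢ}C_𝔓`, so this is §3.  CONSEQUENCE FOR THE GAP LIST: (IDLexact)₃ follows from the INVARIANCE of the two levels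
  `r₁, r₂` of exactly ratio-maximal flags at each generic fibre point `C_𝔓` (a local ring with `𝔪_{T'}C_𝔓 = 𝔪_{C_𝔓}`, flat over `T'`
  both ways) — the shape of the dominance word — plus the side conditions «fibre `κ(T') ⊗_T T'` reduced and Noetherian»; the
  class-membership facts «`C_𝔓` regular of dimension three, formally smooth and e.f.t. over `T'`» needed to move exact maximality to
  `C_𝔓` are NOT proved here.

References: The Stacks Project, Tags 023N/0245; Bruns–Herzog, *Cohen–Macaulay rings*, Lemma 1.2.17 (b); Matsumura, *Commutative Ring
Theory*, Thm. 4.1/§4 (localisation and ideals).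
-/

noncomputable section

open IsLocalRing TensorProduct Algebra.TensorProduct

set_option linter.dupNamespace false -- mandated namespace of this single-conjunct summit

namespace Summit.ResolutionOfSingularities.ResolutionOfSingularities.Cruxes.HypersurfaceCentreConstruction.LocalEngine

namespace FibreDescent

universe u v

/-! ## §1 Minimal primes of a radical ideal, localised -/

section MinimalPrimes

variable {C : Type u} [CommRing C] {F : Ideal C}

/-- At a minimal prime `𝔓` of a radical ideal `F`, `𝔓·C_𝔓 ≤ F·C_𝔓` (every prime of `C_𝔓` containing `F·C_𝔓` contracts to a prime
between `F` and `𝔓`, hence to `𝔓`; so `𝔓·C_𝔓 ≤ rad(F·C_𝔓) = rad(F)·C_𝔓 = F·C_𝔓`). [folklore] -/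
theorem map_le_map_atPrime_of_mem_minimalPrimes (hF : F.IsRadical) (𝔓 : Ideal C) [𝔓.IsPrime] (h𝔓 : 𝔓 ∈ F.minimalPrimes) :
    𝔓.map (algebraMap C (Localization.AtPrime 𝔓)) ≤ F.map (algebraMap C (Localization.AtPrime 𝔓)) := by
  have h1 : 𝔓.map (algebraMap C (Localization.AtPrime 𝔓)) ≤
      (F.map (algebraMap C (Localization.AtPrime 𝔓))).radical := by
    rw [Ideal.radical_eq_sInf, le_sInf_iff]
    rintro Q ⟨hQF, hQprime⟩
    have hQ𝔓 : Q.comap (algebraMap C (Localization.AtPrime 𝔓)) ≤ 𝔓 := by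
      have hQle : Q ≤ maximalIdeal (Localization.AtPrime 𝔓) := IsLocalRing.le_maximalIdeal hQprime.ne_top
      calc Q.comap (algebraMap C (Localization.AtPrime 𝔓))
          ≤ (maximalIdeal (Localization.AtPrime 𝔓)).comap (algebraMap C (Localization.AtPrime 𝔓)) :=
            Ideal.comap_mono hQle
        _ = 𝔓 := Localization.AtPrime.under_maximalIdeal
    have hFQ : F ≤ Q.comap (algebraMap C (Localization.AtPrime 𝔓)) := by
      rw [← Ideal.map_le_iff_le_comap]
      exact hQF
    have hprQ : (Q.comap (algebraMap C (Localization.AtPrime 𝔓))).IsPrime := hQprime.comap _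
    have h𝔓Q : 𝔓 ≤ Q.comap (algebraMap C (Localization.AtPrime 𝔓)) := h𝔓.2 ⟨hprQ, hFQ⟩ hQ𝔓
    rw [Ideal.map_le_iff_le_comap]
    exact h𝔓Q
  rwa [← IsLocalization.map_radical 𝔓.primeCompl (Localization.AtPrime 𝔓) F, hF.radical] at h1

/-- At a minimal prime `𝔓` of a radical ideal `F`, the maximal ideal of `C_𝔓` is `F·C_𝔓`. [folklore] -/
theorem maximalIdeal_atPrime_eq_map_of_mem_minimalPrimes (hF : F.IsRadical) (𝔓 : Ideal C) [𝔓.IsPrime]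
    (h𝔓 : 𝔓 ∈ F.minimalPrimes) :
    maximalIdeal (Localization.AtPrime 𝔓) = F.map (algebraMap C (Localization.AtPrime 𝔓)) := by
  refine le_antisymm ?_ ?_
  · rw [← Localization.AtPrime.map_eq_maximalIdeal]
    exact map_le_map_atPrime_of_mem_minimalPrimes hF 𝔓 h𝔓
  · rw [← Localization.AtPrime.map_eq_maximalIdeal]
    exact Ideal.map_mono h𝔓.1.2

/-- Clearing denominators: membership of `z/1` in `J·C_𝔓` gives `s·z ∈ J` for some `s ∉ 𝔓`. [folklore] -/
theorem exists_mul_mem_of_algebraMap_mem_map_atPrime (𝔓 : Ideal C) [𝔓.IsPrime] (J : Ideal C) {z : C}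
    (hz : algebraMap C (Localization.AtPrime 𝔓) z ∈ J.map (algebraMap C (Localization.AtPrime 𝔓))) :
    ∃ s ∉ 𝔓, s * z ∈ J := by
  rw [IsLocalization.mem_map_algebraMap_iff (M := 𝔓.primeCompl) (S := Localization.AtPrime 𝔓)] at hz
  obtain ⟨⟨a, b⟩, hab⟩ := hz
  rw [← map_mul, IsLocalization.eq_iff_exists (M := 𝔓.primeCompl) (S := Localization.AtPrime 𝔓)] at hab
  obtain ⟨t, ht⟩ := hab
  refine ⟨↑t * ↑b, ?_, ?_⟩
  · intro h
    rcases (inferInstance : 𝔓.IsPrime).mem_or_mem h with h | h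
    · exact t.2 h
    · exact b.2 h
  · have : ↑t * ↑b * z = ↑t * (z * ↑b) := by ring
    rw [this, ht]
    exact J.mul_mem_left _ a.2

end MinimalPrimes

/-! ## §2 The fibre ideal of `T' ⊗_T T'` under `𝔪T' = 𝔪'` and the two maps to a generic point -/

section Fibre

variable {T : Type u} {T' : Type v} [CommRing T] [CommRing T'] [Algebra T T'] [IsLocalRing T] [IsLocalRing T']
  (hm : (maximalIdeal T).map (algebraMap T T') = maximalIdeal T')

include hm

/-- With `𝔪T' = 𝔪'`: `p₁(𝔪')·C = 𝔪·C`. [folklore] -/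
theorem map_includeLeft_maximalIdeal_eq :
    (maximalIdeal T').map (algebraMap T' (T' ⊗[T] T')) = (maximalIdeal T).map (algebraMap T (T' ⊗[T] T')) := by
  rw [← hm, Ideal.map_map, ← IsScalarTower.algebraMap_eq]

/-- With `𝔪T' = 𝔪'`: `p₂(𝔪')·C = 𝔪·C`. [folklore] -/
theorem map_includeRight_maximalIdeal_eq :
    (maximalIdeal T').map ((includeRight : T' →ₐ[T] T' ⊗[T] T') : T' →+* T' ⊗[T] T') =
      (maximalIdeal T).map (algebraMap T (T' ⊗[T] T')) := by
  rw [← hm, Ideal.map_map]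
  congr 1
  exact (includeRight : T' →ₐ[T] T' ⊗[T] T').comp_algebraMap

omit [IsLocalRing T] hm in
/-- **The generic points of the fibre are in the `𝔪`-preserving class, left map**: for a minimal prime `𝔓` of the (radical) fibre
ideal, `q₁(𝔪')·C_𝔓 = 𝔪_{C_𝔓}` with `q₁ : T' → C → C_𝔓` through `p₁`. [folklore] -/
theorem map_maximalIdeal_toAtPrime_left
    (hrad : ((maximalIdeal T').map (algebraMap T' (T' ⊗[T] T'))).IsRadical) (𝔓 : Ideal (T' ⊗[T] T')) [𝔓.IsPrime]
    (h𝔓 : 𝔓 ∈ ((maximalIdeal T').map (algebraMap T' (T' ⊗[T] T'))).minimalPrimes) :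
    (maximalIdeal T').map ((algebraMap (T' ⊗[T] T') (Localization.AtPrime 𝔓)).comp (algebraMap T' (T' ⊗[T] T'))) =
      maximalIdeal (Localization.AtPrime 𝔓) := by
  rw [← Ideal.map_map, maximalIdeal_atPrime_eq_map_of_mem_minimalPrimes hrad 𝔓 h𝔓]

/-- **The generic points of the fibre are in the `𝔪`-preserving class, right map**: `q₂(𝔪')·C_𝔓 = 𝔪_{C_𝔓}` with
`q₂ : T' → C → C_𝔓` through `p₂`. [folklore] -/
theorem map_maximalIdeal_toAtPrime_right
    (hrad : ((maximalIdeal T').map (algebraMap T' (T' ⊗[T] T'))).IsRadical) (𝔓 : Ideal (T' ⊗[T] T')) [𝔓.IsPrime]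
    (h𝔓 : 𝔓 ∈ ((maximalIdeal T').map (algebraMap T' (T' ⊗[T] T'))).minimalPrimes) :
    (maximalIdeal T').map ((algebraMap (T' ⊗[T] T') (Localization.AtPrime 𝔓)).comp
        ((includeRight : T' →ₐ[T] T' ⊗[T] T') : T' →+* T' ⊗[T] T')) =
      maximalIdeal (Localization.AtPrime 𝔓) := by
  rw [← Ideal.map_map, map_includeRight_maximalIdeal_eq hm, ← map_includeLeft_maximalIdeal_eq hm,
    maximalIdeal_atPrime_eq_map_of_mem_minimalPrimes hrad 𝔓 h𝔓]

end Fibre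

/-! ## §3 Descent from the localised datum at the generic points of the fibre -/

section Descent

variable {T : Type u} {T' : Type v} [CommRing T] [CommRing T'] [Algebra T T'] [IsLocalRing T'] [Module.Flat T T']

/-- **DESCENT FROM THE LOCALISED DATUM.**  `T'` local and flat over `T`, `T'/I` of finite length, fibre ideal `F = p₁(𝔪')·(T' ⊗_T T')`
radical with finitely many minimal primes.  If at every minimal prime `𝔓` of `F` the localised datum `I·^{q₂}C_𝔓 ≤ I·^{q₁}C_𝔓`
holds (`qᵢ : T' ⇉ T' ⊗_T T' → C_𝔓`), then `I = (I ∩ T)·T'`.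
[cite: StacksProject, Tag 0245] [cite: BrunsHerzog1998, §1.2 Lemma 1.2.17 (b)] -/
theorem eq_map_comap_of_atPrime (I : Ideal T') (hI : IsFiniteLength T' (T' ⧸ I))
    (hrad : ((maximalIdeal T').map (algebraMap T' (T' ⊗[T] T'))).IsRadical)
    (hfin : ((maximalIdeal T').map (algebraMap T' (T' ⊗[T] T'))).minimalPrimes.Finite)
    (H : ∀ (𝔓 : Ideal (T' ⊗[T] T')) [𝔓.IsPrime],
      𝔓 ∈ ((maximalIdeal T').map (algebraMap T' (T' ⊗[T] T'))).minimalPrimes →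
      I.map ((algebraMap (T' ⊗[T] T') (Localization.AtPrime 𝔓)).comp
          ((includeRight : T' →ₐ[T] T' ⊗[T] T') : T' →+* T' ⊗[T] T')) ≤
        I.map ((algebraMap (T' ⊗[T] T') (Localization.AtPrime 𝔓)).comp (algebraMap T' (T' ⊗[T] T')))) :
    I = (I.comap (algebraMap T T')).map (algebraMap T T') := by
  refine eq_map_comap_of_minimalPrimes I hI hrad hfin fun x hx 𝔓 h𝔓 => ?_
  haveI : 𝔓.IsPrime := h𝔓.1.1
  have hx2 : algebraMap (T' ⊗[T] T') (Localization.AtPrime 𝔓) ((1 : T') ⊗ₜ[T] x) ∈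
      I.map ((algebraMap (T' ⊗[T] T') (Localization.AtPrime 𝔓)).comp
        ((includeRight : T' →ₐ[T] T' ⊗[T] T') : T' →+* T' ⊗[T] T')) :=
    Ideal.mem_map_of_mem _ hx
  have hx1 := H 𝔓 h𝔓 hx2
  rw [← Ideal.map_map] at hx1
  exact exists_mul_mem_of_algebraMap_mem_map_atPrime 𝔓 _ hx1

end Descent

/-! ## §4 The two-flag levels -/

section Flags

variable {T T' : Type u} [CommRing T] [CommRing T'] [Algebra T T'] [IsLocalRing T] [IsLocalRing T'] [IsNoetherianRing T']
  [Module.Flat T T'] (hm : (maximalIdeal T).map (algebraMap T T') = maximalIdeal T')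

include hm

omit [IsLocalRing T] [Module.Flat T T'] hm in
/-- The degree-`n` level of a two-flag filtration contains `𝔪'^⌈n/q⌉`, so `T'/F'` has finite length. [folklore] -/
theorem isFiniteLength_quotient_flagContactFiltration (g₁' g₂' : T') (q r₁ r₂ n : ℕ) :
    IsFiniteLength T' (T' ⧸ Iota3.flagContactFiltration g₁' g₂' q r₁ r₂ n) := by
  refine Literature.AlgebraicGeometry.Resolution.Matsumura1987.isFiniteLength_quotient_of_pow_le
    (n := (n - r₁ * 0 - r₂ * 0 + q - 1) / q) ?_
  rw [Iota3.flagContactFiltration_def]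
  refine le_iSup_of_le 0 (le_iSup_of_le 0 ?_)
  rw [pow_zero, pow_zero, mul_one, Ideal.span_singleton_one, Ideal.top_mul]

/-- **THE TWO-FLAG LEVELS ARE EXTENDED ONCE THEY ARE INVARIANT AT THE GENERIC POINTS OF THE FIBRE.**  `T → T'` local rings, `T'`
Noetherian and flat over `T`, `𝔪T' = 𝔪'`, fibre ideal `𝔪·(T' ⊗_T T')` radical with finitely many minimal primes.  Fix a pair
`(g₁', g₂')` of `T'`, weights `(q; r₁, r₂)` and a degree `n`.  If at every minimal prime `𝔓` of the fibre ideal the degree-`n` level of the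
image pair under `q₂ : T' → C_𝔓` lies in that of the image pair under `q₁`, then the level `flagContactFiltration g₁' g₂' q r₁ r₂ n` is
extended from `T`. [cite: StacksProject, Tag 0245] [cite: BrunsHerzog1998, §1.2 Lemma 1.2.17 (b)] -/
theorem flagLevel_extended_of_generic_invariance
    (hrad : ((maximalIdeal T').map (algebraMap T' (T' ⊗[T] T'))).IsRadical)
    (hfin : ((maximalIdeal T').map (algebraMap T' (T' ⊗[T] T'))).minimalPrimes.Finite)
    (g₁' g₂' : T') (q r₁ r₂ n : ℕ)
    (HINV : ∀ (𝔓 : Ideal (T' ⊗[T] T')) [𝔓.IsPrime],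
      𝔓 ∈ ((maximalIdeal T').map (algebraMap T' (T' ⊗[T] T'))).minimalPrimes →
      Iota3.flagContactFiltration
          (algebraMap (T' ⊗[T] T') (Localization.AtPrime 𝔓) ((1 : T') ⊗ₜ[T] g₁'))
          (algebraMap (T' ⊗[T] T') (Localization.AtPrime 𝔓) ((1 : T') ⊗ₜ[T] g₂')) q r₁ r₂ n ≤
        Iota3.flagContactFiltration
          (algebraMap (T' ⊗[T] T') (Localization.AtPrime 𝔓) (g₁' ⊗ₜ[T] (1 : T')))
          (algebraMap (T' ⊗[T] T') (Localization.AtPrime 𝔓) (g₂' ⊗ₜ[T] (1 : T'))) q r₁ r₂ n) :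
    ∃ J : Ideal T, J.map (algebraMap T T') = Iota3.flagContactFiltration g₁' g₂' q r₁ r₂ n := by
  refine ⟨(Iota3.flagContactFiltration g₁' g₂' q r₁ r₂ n).comap (algebraMap T T'), ?_⟩
  refine (eq_map_comap_of_atPrime _ (isFiniteLength_quotient_flagContactFiltration g₁' g₂' q r₁ r₂ n) hrad hfin
    fun 𝔓 _ h𝔓 => ?_).symm
  rw [Iota3.map_flagContactFiltration_eq _ (map_maximalIdeal_toAtPrime_right hm hrad 𝔓 h𝔓),
    Iota3.map_flagContactFiltration_eq _ (map_maximalIdeal_toAtPrime_left hrad 𝔓 h𝔓)]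
  exact HINV 𝔓 h𝔓

end Flags

end FibreDescent

end Summit.ResolutionOfSingularities.ResolutionOfSingularities.Cruxes.HypersurfaceCentreConstruction.LocalEngine

end
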